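import Literature.NumberTheory.EllipticCurves.ThreeTorsionFakePointSwanProofs
import HarnessLib

/-!
# The fake-point form of the Galois side of Ogg's formula at `2`: products and transitivity

`Proofs` file (theorems only, no definitions, no named facts) in topic
`NumberTheory/EllipticCurves`, landed by the seat of bsd.S15
(`Literature.NumberTheory.EllipticCurves.conductorNorm_eq_artinConductorNat_of_isElliptic`),
continuing `ThreeTorsionFakePointSwanProofs`.  There the break of the central involution of
`L = K(E[3]) ⊇ E = K(x(E[3]))` was read off one fake point `(P, c)` with test elements
`Z_ε = P(X_ε)² - c²(X_ε³ - 27c₄X_ε - 54c₆) ∈ S_E`, `X_ε = 3(ε₀R₀ + ε₁R₁ + ε₂R₂)`, given the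
`𝔓_E`-orders `n = v(Z)`, `n₀ = v(X₁³ - 27c₄X₁ - 54c₆)`, `m_j = v(Z_j - Z)` and the hypotheses "`L`
wildly ramified" and "`#Q₁(𝔓 ∩ E) = 4`".  Here these `E`-level orders are replaced by orders of
**products over the sign changes**, which lie in `K(ζ₃, ∛Δ)` and are computable uniformly on a
`(c₄, c₆)`-congruence class:

* `card_mul_swanConductorAt_torsion_three_eq_of_fakePoint_prod` —
  **`#Q₀ · Sw_𝔓(E[3]) = 2 ((2κ + n₀ - n) + Σ_{j=2}^{4} (m_j - n))`** from `#Q₁(𝔓 ∩ E) = 4`,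
  `v(Z Z₂ Z₃ Z₄) = 4n` (`n` a unit mod `𝔓`), `v(2) = o₂`, `v(Δ) = o_Δ`, `4 n₀ = 16 o₂ + 2 o_Δ`,
  `v(2c) = κ`, `v((Z - Z₂)(Z₃ - Z₄)) = 2m₂`, `v((Z - Z₃)(Z₂ - Z₄)) = 2m₃`,
  `v((Z - Z₄)(Z₂ - Z₃)) = 2m₄` (all `v = v_{𝔓_E}`), for `c₆ ≠ 0` and `Δ ∈ 𝓞_K`.

Proof.  (S1) An element of the inertia group `Q₀` fixes `ζ = ζ₃ ∈ S_E` (else `ζ² - ζ ∈ 𝔓_E`, but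
`(ζ² - ζ)² = -3` and `3 ∉ 𝔓`), and an element `g` of `Q₁` (a group of order `4`) fixes `δ = ∛Δ`
(`gδ ∈ {δ, ζδ, ζ²δ}` and `g⁴ = 1`).  (S2) Hence a lift `σ ∈ Γ_K` of `g ∈ Q₁` has `σR_k = ±R_k`
(`R_k² = c₄ - 12ζ^kδ`) with signs multiplying to `+1` (`R₀R₁R₂ = c₆ ≠ 0`); since `E = K(R₀, R₁, R₂)`
(`absRestrictNormalHom_xDivisionField_three_eq_one_iff_radical`) the sign map `Q₁ → {±1}²` is
injective, so bijective: `Q₁` is the four-group of even sign changes.  (S3) `Q₁ ⊆ Q₀` preserves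
`v_{𝔓_E}` (`ord_smul`) and permutes the `Z_ε` (and the `X_ε³ - 27c₄X_ε - 54c₆`) transitively, and
`(-,+,-)` maps `Z - Z₂` to `Z₃ - Z₄` etc.; so `4 v(Z) = v(∏ Z_ε)`, `2 v(Z - Z₂) = v((Z - Z₂)(Z₃ - Z₄))`,
…, and `4 v(X₁³ - 27c₄X₁ - 54c₆) = v(∏_ε (X_ε³ - 27c₄X_ε - 54c₆)) = v(-2¹⁶3²¹Δ²)` (the identity
`∏_ε (X_ε³ - 27c₄X_ε - 54c₆) = -2¹⁶ 3²¹ Δ²` in `ℤ[ζ, δ, R₀, R₁, R₂]/(relations)`, i.e. the norm of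
`y²`-type coordinates; staged `linear_combination`s).  (S4) `L/K` is wildly ramified at `𝔓`:
`4 = #Q₁ ∣ #Q₀ ∣ #G₀` (`Q₀ = π(G₀)`, `map_inertia_restrictNormalHom`,
`card_ramificationSubgroup_layer_eq`) and `#G₁ = 2^{v₂(#G₀)}`
(`card_ramificationSubgroup_one_eq_two_pow_of_mem_primesAbove`).  Then
`card_mul_swanConductorAt_torsion_three_eq_of_fakePoint`.

Instance convention as in `ThreeTorsionFakePointSwanProofs` (`IntermediateField.algebra'`,
`AlgebraicClosure.instAlgebra` as the `𝓞 K`-algebra structures; definitionally equal to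
`NumberField.RingOfIntegers.instAlgebra`).

## References
* J.-P. Serre, *Local Fields*, GTM 67, Springer 1979, Ch. I §7 (Prop. 20–22), Ch. IV §1–§2.
* J. H. Silverman, *Advanced Topics in the Arithmetic of Elliptic Curves*, GTM 151, Springer 1994,
  Ch. IV §10–§11 (Ogg's formula, Thm. 11.1). [cite: SilvermanATAEC1994, Thm. IV.11.1]
* J. H. Silverman, *The Arithmetic of Elliptic Curves*, GTM 106, 2nd ed. 2009, III §1 (`c₄, c₆, Δ`,
  `1728Δ = c₄³ - c₆²`). [cite: SilvermanAEC2009, III.1]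
-/

noncomputable section

open scoped Classical NumberField Pointwise
open Field IsDedekindDomain Polynomial

namespace WeierstrassCurve

open Literature.NumberTheory.EllipticCurves Literature.NumberTheory.GaloisRepresentations

attribute [local instance] AddSubgroup.torsionBy.zmodModule
attribute [local instance 1001] IntermediateField.algebra'
attribute [local instance 1002] AlgebraicClosure.instAlgebra

variable {K : Type} [Field K] [NumberField K] (W : WeierstrassCurve K)

set_option maxHeartbeats 1600000 in
set_option synthInstance.maxHeartbeats 400000 in
/-- **`#Q₀ · Sw_𝔓(E[3]) = 2 ((2κ + n₀ - n) + Σ_j (m_j - n))` from product valuations.**  Setting of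
`card_mul_swanConductorAt_torsion_three_eq_of_fakePoint` (`K` a number field, `v ∣ 2`, `3 ∉ v`,
`𝔓 ∣ v`, radicals `ζ, δ, R_k` of `E[3]`, a fake point `(P, c)` with test elements `Z_ε ∈ S_E`,
`E = K(x(E[3]))`), with `c₆ ≠ 0`, `Δ = D ∈ 𝓞_K`, `#Q₁(𝔓 ∩ E) = 4`, the elements
`Y_ε = X_ε³ - 27c₄X_ε - 54c₆ ∈ S_E`, and the `𝔓_E`-orders of products: `v(Z Z₂ Z₃ Z₄) = 4n` with
`n` a unit mod `𝔓`, `v(2) = o₂`, `v(D) = o_Δ`, `4n₀ = 16 o₂ + 2 o_Δ`, `v(2c) = κ`,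
`v((Z - Z₂)(Z₃ - Z₄)) = 2m₂`, `v((Z - Z₃)(Z₂ - Z₄)) = 2m₃`, `v((Z - Z₄)(Z₂ - Z₃)) = 2m₄`,
`m_j - n ≤ 2κ + n₀ - n`.  Then `#Q₀(𝔓 ∩ E) · Sw_𝔓(E[3]) = 2 ((2κ + n₀ - n) + Σ_{j=2}^4 (m_j - n))`.
(`Q₁` is the four-group of even sign changes of `(R₀, R₁, R₂)` and lies in the inertia group, so
`v(Z_ε) = v(Z)`, `v(Y_ε) = v(Y₁)`, `v(Z₃ - Z₄) = v(Z - Z₂)`, …; `∏ Y_ε = -2¹⁶3²¹Δ²`; `K(E[3])` is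
wildly ramified at `𝔓` since `4 ∣ #Q₀ ∣ #G₀`.)
Ref: Serre, *Local Fields*, Ch. I §7 Prop. 20–22, Ch. IV §1 Prop. 2–3; Silverman *ATAEC*
Thm. IV.11.1 (`δ_𝔓` at `p = 2`). [cite: SerreLocalFields1979, Ch. IV §1–§2]
[cite: SilvermanATAEC1994, Thm. IV.11.1] -/
theorem card_mul_swanConductorAt_torsion_three_eq_of_fakePoint_prod [W.IsElliptic]
    {v : HeightOneSpectrum (𝓞 K)} (hv2 : (2 : 𝓞 K) ∈ v.asIdeal) (h3 : ((3 : ℕ) : 𝓞 K) ∉ v.asIdeal)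
    {𝔓 : Ideal (absIntegers (𝓞 K) K)} (h𝔓 : 𝔓 ∈ v.primesAbove)
    -- radical data
    {ζ δ R₀ R₁ R₂ : AlgebraicClosure K} (hζ : ζ ^ 2 + ζ + 1 = 0)
    (hδ : δ ^ 3 = algebraMap K (AlgebraicClosure K) W.Δ)
    (h₀ : R₀ ^ 2 = algebraMap K (AlgebraicClosure K) W.c₄ - 12 * δ)
    (h₁ : R₁ ^ 2 = algebraMap K (AlgebraicClosure K) W.c₄ - 12 * ζ * δ)
    (h₂ : R₂ ^ 2 = algebraMap K (AlgebraicClosure K) W.c₄ - 12 * ζ ^ 2 * δ)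
    (hρ : R₀ * R₁ * R₂ = algebraMap K (AlgebraicClosure K) W.c₆) (hc₆ : W.c₆ ≠ 0)
    {D : 𝓞 K} (hD : algebraMap (𝓞 K) K D = W.Δ)
    -- quaternion wild inertia of the x-field
    (hcard : Nat.card ((𝔓.comap ((W.xDivisionField 3).integralClosureToAbsIntegers (𝓞 K))).ramificationSubgroup
      (W.xDivisionField 3 ≃ₐ[K] W.xDivisionField 3) 1) = 4)
    -- the fake point and the `Y`'s
    {Z Z₂ Z₃ Z₄ Y₀ Y₂ Y₃ Y₄ : integralClosure (𝓞 K) (W.xDivisionField 3)} {P : Polynomial (𝓞 K)} {c : 𝓞 K}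
    (hZ : ((Z : W.xDivisionField 3) : AlgebraicClosure K) =
      (P.map (algebraMap (𝓞 K) (AlgebraicClosure K))).eval (3 * (R₀ + R₁ + R₂)) ^ 2 -
        algebraMap (𝓞 K) (AlgebraicClosure K) c ^ 2 * ((3 * (R₀ + R₁ + R₂)) ^ 3 - 27 * algebraMap K _ W.c₄ * (3 * (R₀ + R₁ + R₂))
          - 54 * algebraMap K _ W.c₆))
    (hZ₂ : ((Z₂ : W.xDivisionField 3) : AlgebraicClosure K) =
      (P.map (algebraMap (𝓞 K) (AlgebraicClosure K))).eval (3 * (R₀ - R₁ - R₂)) ^ 2 -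
        algebraMap (𝓞 K) (AlgebraicClosure K) c ^ 2 * ((3 * (R₀ - R₁ - R₂)) ^ 3 - 27 * algebraMap K _ W.c₄ * (3 * (R₀ - R₁ - R₂))
          - 54 * algebraMap K _ W.c₆))
    (hZ₃ : ((Z₃ : W.xDivisionField 3) : AlgebraicClosure K) =
      (P.map (algebraMap (𝓞 K) (AlgebraicClosure K))).eval (3 * (-R₀ + R₁ - R₂)) ^ 2 -
        algebraMap (𝓞 K) (AlgebraicClosure K) c ^ 2 * ((3 * (-R₀ + R₁ - R₂)) ^ 3 - 27 * algebraMap K _ W.c₄ * (3 * (-R₀ + R₁ - R₂))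
          - 54 * algebraMap K _ W.c₆))
    (hZ₄ : ((Z₄ : W.xDivisionField 3) : AlgebraicClosure K) =
      (P.map (algebraMap (𝓞 K) (AlgebraicClosure K))).eval (3 * (-R₀ - R₁ + R₂)) ^ 2 -
        algebraMap (𝓞 K) (AlgebraicClosure K) c ^ 2 * ((3 * (-R₀ - R₁ + R₂)) ^ 3 - 27 * algebraMap K _ W.c₄ * (3 * (-R₀ - R₁ + R₂))
          - 54 * algebraMap K _ W.c₆))
    (hY₀ : ((Y₀ : W.xDivisionField 3) : AlgebraicClosure K) =
      (3 * (R₀ + R₁ + R₂)) ^ 3 - 27 * algebraMap K _ W.c₄ * (3 * (R₀ + R₁ + R₂)) - 54 * algebraMap K _ W.c₆)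
    (hY₂ : ((Y₂ : W.xDivisionField 3) : AlgebraicClosure K) =
      (3 * (R₀ - R₁ - R₂)) ^ 3 - 27 * algebraMap K _ W.c₄ * (3 * (R₀ - R₁ - R₂)) - 54 * algebraMap K _ W.c₆)
    (hY₃ : ((Y₃ : W.xDivisionField 3) : AlgebraicClosure K) =
      (3 * (-R₀ + R₁ - R₂)) ^ 3 - 27 * algebraMap K _ W.c₄ * (3 * (-R₀ + R₁ - R₂)) - 54 * algebraMap K _ W.c₆)
    (hY₄ : ((Y₄ : W.xDivisionField 3) : AlgebraicClosure K) =
      (3 * (-R₀ - R₁ + R₂)) ^ 3 - 27 * algebraMap K _ W.c₄ * (3 * (-R₀ - R₁ + R₂)) - 54 * algebraMap K _ W.c₆)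
    {s₀ : integralClosure (𝓞 K) (W.xDivisionField 3)}
    (hs₀ : ((s₀ : W.xDivisionField 3) : AlgebraicClosure K) =
      (P.map (algebraMap (𝓞 K) (AlgebraicClosure K))).eval (3 * (R₀ + R₁ + R₂)))
    -- valuation data of products
    {n n₀ κ m₂ m₃ m₄ o₂ oD : ℕ}
    (hZprod : ord (𝔓.comap ((W.xDivisionField 3).integralClosureToAbsIntegers (𝓞 K))) (Z * Z₂ * Z₃ * Z₄) =
      ((4 * n : ℕ) : ℕ∞))
    (hnu : (n : integralClosure (𝓞 K) (W.xDivisionField 3)) ∉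
      𝔓.comap ((W.xDivisionField 3).integralClosureToAbsIntegers (𝓞 K)))
    (ho₂ : ord (𝔓.comap ((W.xDivisionField 3).integralClosureToAbsIntegers (𝓞 K)))
      (2 : integralClosure (𝓞 K) (W.xDivisionField 3)) = o₂)
    (hoD : ord (𝔓.comap ((W.xDivisionField 3).integralClosureToAbsIntegers (𝓞 K)))
      (algebraMap (𝓞 K) (integralClosure (𝓞 K) (W.xDivisionField 3)) D) = oD)
    (hn₀ : 4 * n₀ = 16 * o₂ + 2 * oD)
    (hκ : ord (𝔓.comap ((W.xDivisionField 3).integralClosureToAbsIntegers (𝓞 K)))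
      (algebraMap (𝓞 K) (integralClosure (𝓞 K) (W.xDivisionField 3)) (2 * c)) = κ)
    (hE₀ : ord (𝔓.comap ((W.xDivisionField 3).integralClosureToAbsIntegers (𝓞 K))) ((Z - Z₂) * (Z₃ - Z₄)) =
      ((2 * m₂ : ℕ) : ℕ∞))
    (hE₁ : ord (𝔓.comap ((W.xDivisionField 3).integralClosureToAbsIntegers (𝓞 K))) ((Z - Z₃) * (Z₂ - Z₄)) =
      ((2 * m₃ : ℕ) : ℕ∞))
    (hE₂ : ord (𝔓.comap ((W.xDivisionField 3).integralClosureToAbsIntegers (𝓞 K))) ((Z - Z₄) * (Z₂ - Z₃)) =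
      ((2 * m₄ : ℕ) : ℕ∞))
    (hm₂b : m₂ - n ≤ 2 * κ + n₀ - n) (hm₃b : m₃ - n ≤ 2 * κ + n₀ - n) (hm₄b : m₄ - n ≤ 2 * κ + n₀ - n) :
    (Nat.card ((𝔓.comap ((W.xDivisionField 3).integralClosureToAbsIntegers (𝓞 K))).ramificationSubgroup
        (W.xDivisionField 3 ≃ₐ[K] W.xDivisionField 3) 0) : ℝ) *
        (W.torsionGaloisRep 3).swanConductorAt (𝓞 K) 𝔓 =
      2 * ((2 * κ + n₀ - n : ℕ) + (((m₂ - n) + (m₃ - n) + (m₄ - n) : ℕ) : ℝ)) := by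
  classical
  haveI : Fact (Nat.Prime 3) := ⟨Nat.prime_three⟩
  have h2K : (2 : K) ≠ 0 := two_ne_zero
  have h3K : (3 : K) ≠ 0 := three_ne_zero
  -- instances for `E = K(x(E[3]))`
  haveI hDDE : IsDedekindDomain (integralClosure (𝓞 K) (W.xDivisionField 3)) :=
    integralClosure.isDedekindDomain (𝓞 K) K (W.xDivisionField 3)
  haveI : 𝔓.IsPrime := h𝔓.1
  haveI h𝔓max : 𝔓.IsMaximal := HeightOneSpectrum.isMaximal_of_mem_primesAbove h𝔓
  haveI : IsGalois K (W.xDivisionField 3) := {}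
  haveI hPEmax : (𝔓.comap ((W.xDivisionField 3).integralClosureToAbsIntegers (𝓞 K))).IsMaximal :=
    isMaximal_comap_integralClosureToAbsIntegers (𝓞 K) 𝔓 (W.xDivisionField 3)
  have hunderE : (𝔓.comap ((W.xDivisionField 3).integralClosureToAbsIntegers (𝓞 K))).under (𝓞 K) = v.asIdeal := by
    rw [under_comap_integralClosureToAbsIntegers, ← h𝔓.2.over]
  have hPE0 : (𝔓.comap ((W.xDivisionField 3).integralClosureToAbsIntegers (𝓞 K))) ≠ ⊥ := by
    intro h0
    have hinj : Function.Injective (algebraMap (𝓞 K) (integralClosure (𝓞 K) (W.xDivisionField 3))) :=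
      (faithfulSMul_iff_algebraMap_injective _ _).mp
        (faithfulSMul_integralClosure (𝓞 K) (K := K) (L := (W.xDivisionField 3)))
    have h2' : (2 : 𝓞 K) ∈ (𝔓.comap ((W.xDivisionField 3).integralClosureToAbsIntegers (𝓞 K))).under (𝓞 K) := by
      rw [hunderE]; exact hv2
    rw [Ideal.under_def, Ideal.mem_comap, h0, Ideal.mem_bot] at h2'
    exact two_ne_zero (hinj (h2'.trans (map_zero _).symm))
  have h3E : (3 : integralClosure (𝓞 K) (W.xDivisionField 3)) ∉
      𝔓.comap ((W.xDivisionField 3).integralClosureToAbsIntegers (𝓞 K)) := by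
    intro hmem
    apply h3
    rw [← hunderE, Ideal.under_def, Ideal.mem_comap, map_natCast]
    exact_mod_cast hmem
  -- the radicals lie in `E`; non-vanishing
  obtain ⟨mR₀, mR₁, mR₂⟩ := W.radical_mem_xDivisionField_three h2K h3K hζ hδ h₀ h₁ h₂ hρ
  obtain ⟨mζ, mδ⟩ := W.zeta_mem_and_delta_mem_xDivisionField_three h2K h3K hζ hδ h₀ h₁ h₂ hρ
  have hδ0 : δ ≠ 0 := by
    intro h0
    rw [h0, zero_pow three_ne_zero] at hδ
    exact W.isUnit_Δ.ne_zero ((_root_.map_eq_zero_iff _ (algebraMap K (AlgebraicClosure K)).injective).mp hδ.symm)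
  have hRne : R₀ ≠ 0 ∧ R₁ ≠ 0 ∧ R₂ ≠ 0 := by
    have hprod : R₀ * R₁ * R₂ ≠ 0 := by
      rw [hρ]; exact (_root_.map_ne_zero _).mpr hc₆
    exact ⟨fun h => hprod (by rw [h]; ring), fun h => hprod (by rw [h]; ring), fun h => hprod (by rw [h]; ring)⟩
  obtain ⟨hR₀ne, hR₁ne, hR₂ne⟩ := hRne
  have hζ1 : ζ ≠ 1 := by
    intro h; rw [h] at hζ; norm_num at hζ
  have hζ3 : ζ ^ 3 = 1 := by linear_combination (ζ - 1) * hζ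
  -- Galois action on values: `((g • X : S_E) : E) : K̄) = σ • X` for a lift `σ` of `g`
  have hres : ∀ (g : W.xDivisionField 3 ≃ₐ[K] W.xDivisionField 3) (σ : absoluteGaloisGroup K),
      absRestrictNormalHom (W.xDivisionField 3) σ = g →
      ∀ X : integralClosure (𝓞 K) (W.xDivisionField 3),
        (((g • X : integralClosure (𝓞 K) (W.xDivisionField 3)) : W.xDivisionField 3) : AlgebraicClosure K) =
          σ • ((X : W.xDivisionField 3) : AlgebraicClosure K) := by
    intro g σ hσ X
    rw [integralClosure.coe_smul, ← hσ]
    exact AlgEquiv.restrictNormal_commutes (absoluteGaloisGroup.toAlgEquiv K σ) (W.xDivisionField 3) X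
  have hresf : ∀ (g : W.xDivisionField 3 ≃ₐ[K] W.xDivisionField 3) (σ : absoluteGaloisGroup K),
      absRestrictNormalHom (W.xDivisionField 3) σ = g →
      ∀ e : W.xDivisionField 3, ((g e : W.xDivisionField 3) : AlgebraicClosure K) =
        σ • (e : AlgebraicClosure K) := by
    intro g σ hσ e
    rw [← hσ]
    exact AlgEquiv.restrictNormal_commutes (absoluteGaloisGroup.toAlgEquiv K σ) (W.xDivisionField 3) e
  have hinjE : ∀ {X Y : integralClosure (𝓞 K) (W.xDivisionField 3)},
      ((X : W.xDivisionField 3) : AlgebraicClosure K) = ((Y : W.xDivisionField 3) : AlgebraicClosure K) →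
        X = Y := fun h => Subtype.ext (Subtype.ext h)
  -- the integral elements `ζE`, `δE`
  have hζmem3 : (⟨ζ, mζ⟩ : W.xDivisionField 3) ^ 3 = 1 := Subtype.ext (by push_cast; exact hζ3)
  have hζint : _root_.IsIntegral (𝓞 K) (⟨ζ, mζ⟩ : W.xDivisionField 3) :=
    IsIntegral.of_pow three_pos (by rw [hζmem3]; exact isIntegral_one)
  have hDval : ((algebraMap (𝓞 K) (W.xDivisionField 3) D : W.xDivisionField 3) : AlgebraicClosure K) =
      algebraMap K (AlgebraicClosure K) W.Δ := by
    rw [← hD]; rfl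
  have hδmem3 : (⟨δ, mδ⟩ : W.xDivisionField 3) ^ 3 = algebraMap (𝓞 K) (W.xDivisionField 3) D :=
    Subtype.ext (by push_cast; rw [hδ]; exact hDval.symm)
  have hδint : _root_.IsIntegral (𝓞 K) (⟨δ, mδ⟩ : W.xDivisionField 3) :=
    IsIntegral.of_pow three_pos (by rw [hδmem3]; exact isIntegral_algebraMap)
  set ζE : integralClosure (𝓞 K) (W.xDivisionField 3) := ⟨⟨ζ, mζ⟩, hζint⟩ with hζEdef
  set δE : integralClosure (𝓞 K) (W.xDivisionField 3) := ⟨⟨δ, mδ⟩, hδint⟩ with hδEdef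
  have hζEval : ((ζE : W.xDivisionField 3) : AlgebraicClosure K) = ζ := rfl
  have hδEval : ((δE : W.xDivisionField 3) : AlgebraicClosure K) = δ := rfl
  have hζE : ζE ^ 2 + ζE + 1 = 0 := hinjE (by push_cast; rw [hζEval]; exact hζ)
  have hζE3 : ζE ^ 3 = 1 := by linear_combination (ζE - 1) * hζE
  have hδE0 : δE ≠ 0 := by
    intro h0
    apply hδ0
    rw [← hδEval, h0]
    rfl
  have hζE1 : ζE ≠ 1 := by
    intro h1
    apply hζ1
    rw [← hζEval, h1]
    rfl
  -- (S1) elements of `Q₀` fix `ζE`; elements of `Q₁` fix `δE`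
  have hfixζ : ∀ g ∈ (𝔓.comap ((W.xDivisionField 3).integralClosureToAbsIntegers (𝓞 K))).ramificationSubgroup
      (W.xDivisionField 3 ≃ₐ[K] W.xDivisionField 3) 0, g • ζE = ζE := by
    intro g hg
    have hmem := (Ideal.mem_ramificationSubgroup_iff.mp hg).2 ζE
    rw [zero_add, pow_one] at hmem
    have hq : (g • ζE) ^ 2 + g • ζE + 1 = 0 := by
      have : g • (ζE ^ 2 + ζE + 1) = 0 := by rw [hζE, smul_zero]
      rwa [smul_add, smul_add, smul_pow', smul_one] at this
    have hfac : (g • ζE - ζE) * (g • ζE - ζE ^ 2) = 0 := by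
      linear_combination hq + (ζE - 1 - g • ζE) * hζE
    rcases mul_eq_zero.mp hfac with h1 | h1
    · exact sub_eq_zero.mp h1
    · exfalso
      rw [sub_eq_zero.mp h1] at hmem
      have hsq : (ζE ^ 2 - ζE) ^ 2 = -3 := by linear_combination (ζE ^ 2 - 3 * ζE + 3) * hζE
      apply h3E
      have : (3 : integralClosure (𝓞 K) (W.xDivisionField 3)) = -((ζE ^ 2 - ζE) * (ζE ^ 2 - ζE)) := by
        rw [← sq, hsq, neg_neg]
      rw [this]
      exact neg_mem (Ideal.mul_mem_left _ _ hmem)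
  have hQ10 : (𝔓.comap ((W.xDivisionField 3).integralClosureToAbsIntegers (𝓞 K))).ramificationSubgroup
      (W.xDivisionField 3 ≃ₐ[K] W.xDivisionField 3) 1 ≤
      (𝔓.comap ((W.xDivisionField 3).integralClosureToAbsIntegers (𝓞 K))).ramificationSubgroup
      (W.xDivisionField 3 ≃ₐ[K] W.xDivisionField 3) 0 :=
    Ideal.ramificationSubgroup_antitone _ _ (Nat.zero_le 1)
  have hpow4 : ∀ g ∈ (𝔓.comap ((W.xDivisionField 3).integralClosureToAbsIntegers (𝓞 K))).ramificationSubgroup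
      (W.xDivisionField 3 ≃ₐ[K] W.xDivisionField 3) 1, g ^ 4 = 1 := by
    intro g hg
    have h := orderOf_dvd_natCard (⟨g, hg⟩ : (𝔓.comap ((W.xDivisionField 3).integralClosureToAbsIntegers (𝓞 K))).ramificationSubgroup
      (W.xDivisionField 3 ≃ₐ[K] W.xDivisionField 3) 1)
    rw [hcard, orderOf_dvd_iff_pow_eq_one] at h
    exact congrArg Subtype.val h
  have hfixδ : ∀ g ∈ (𝔓.comap ((W.xDivisionField 3).integralClosureToAbsIntegers (𝓞 K))).ramificationSubgroup
      (W.xDivisionField 3 ≃ₐ[K] W.xDivisionField 3) 1, g • δE = δE := by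
    intro g hg
    have hgζ := hfixζ g (hQ10 hg)
    have hgζ' : ∀ k : ℕ, (g ^ k) • ζE = ζE := by
      intro k
      induction k with
      | zero => rw [pow_zero, one_smul]
      | succ k ih => rw [pow_succ, mul_smul, hgζ, ih]
    have hδE3 : δE ^ 3 = algebraMap (𝓞 K) _ D := by
      apply hinjE
      push_cast
      rw [hδEval, hδ]
      exact hDval.symm
    have hcube : (g • δE) ^ 3 = δE ^ 3 := by
      rw [← smul_pow', hδE3]
      apply hinjE
      obtain ⟨σ, hσ⟩ := absRestrictNormalHom_surjective' (W.xDivisionField 3) g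
      rw [hres g σ hσ]
      change σ • (((algebraMap (𝓞 K) (W.xDivisionField 3) D : W.xDivisionField 3) : AlgebraicClosure K)) = _
      rw [hDval, smul_algebraMap]
      exact hDval.symm
    have hfac : (g • δE - δE) * (g • δE - ζE * δE) * (g • δE - ζE ^ 2 * δE) = 0 := by
      linear_combination hcube + (-(δE * (g • δE) ^ 2) + ζE * δE ^ 2 * (g • δE) - (ζE - 1) * δE ^ 3) * hζE
    rcases mul_eq_zero.mp hfac with h12 | h3c
    · rcases mul_eq_zero.mp h12 with h1 | h2c
      · exact sub_eq_zero.mp h1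
      · exfalso
        have ha : g • δE = ζE * δE := sub_eq_zero.mp h2c
        have hg2 : (g ^ 2) • δE = ζE ^ 2 * δE := by
          rw [pow_two, mul_smul, ha, smul_mul', hgζ, ha]; ring
        have hg4 : (g ^ 4) • δE = ζE ^ 4 * δE := by
          rw [show g ^ 4 = g ^ 2 * g ^ 2 by rw [← pow_add], mul_smul, hg2, smul_mul', smul_pow', hgζ' 2, hg2]
          ring
        rw [hpow4 g hg, one_smul] at hg4
        have h4 : (ζE ^ 4 - 1) * δE = 0 := by linear_combination (-1 : integralClosure (𝓞 K) (W.xDivisionField 3)) * hg4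
        rcases mul_eq_zero.mp h4 with h | h
        · apply hζE1
          linear_combination h - ζE * hζE3
        · exact hδE0 h
    · exfalso
      have ha : g • δE = ζE ^ 2 * δE := sub_eq_zero.mp h3c
      have hg2 : (g ^ 2) • δE = ζE ^ 4 * δE := by
        rw [pow_two, mul_smul, ha, smul_mul', smul_pow', hgζ, ha]; ring
      have hg4 : (g ^ 4) • δE = ζE ^ 8 * δE := by
        rw [show g ^ 4 = g ^ 2 * g ^ 2 by rw [← pow_add], mul_smul, hg2, smul_mul', smul_pow', hgζ' 2, hg2]
        ring
      rw [hpow4 g hg, one_smul] at hg4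
      have h8 : (ζE ^ 8 - 1) * δE = 0 := by linear_combination (-1 : integralClosure (𝓞 K) (W.xDivisionField 3)) * hg4
      rcases mul_eq_zero.mp h8 with h | h
      · have e1 : ζE ^ 2 = 1 := by linear_combination h - (ζE ^ 2 * (ζE ^ 3 + 1)) * hζE3
        have e3 : (3 : integralClosure (𝓞 K) (W.xDivisionField 3)) = 0 := by
          linear_combination (ζE - 1) * e1 + (2 - ζE) * hζE
        exact h3E (by rw [e3]; exact Ideal.zero_mem _)
      · exact hδE0 h
  -- numerals are fixed by `Γ_K`
  have hnumσ : ∀ (σ : absoluteGaloisGroup K) (m : ℕ), σ • ((m : AlgebraicClosure K)) = m := fun σ m ↦ by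
    rw [show ((m : AlgebraicClosure K)) = algebraMap K (AlgebraicClosure K) m from (map_natCast _ m).symm]
    exact smul_algebraMap σ (m : K)
  -- (S2) a lift `σ` of `g ∈ Q₁` fixes `ζ, δ`, hence `σ R_k = ± R_k`
  obtain ⟨Q1, hQ1⟩ : ∃ Q1 : Subgroup (W.xDivisionField 3 ≃ₐ[K] W.xDivisionField 3),
      Q1 = (𝔓.comap ((W.xDivisionField 3).integralClosureToAbsIntegers (𝓞 K))).ramificationSubgroup
        (W.xDivisionField 3 ≃ₐ[K] W.xDivisionField 3) 1 := ⟨_, rfl⟩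
  have hcard1 : Nat.card Q1 = 4 := by rw [hQ1]; exact hcard
  have hmem1 : ∀ g, g ∈ Q1 → g ∈ (𝔓.comap ((W.xDivisionField 3).integralClosureToAbsIntegers (𝓞 K))).ramificationSubgroup
      (W.xDivisionField 3 ≃ₐ[K] W.xDivisionField 3) 1 := fun g hg => hQ1 ▸ hg
  have hstab : ∀ g, g ∈ Q1 → g • (𝔓.comap ((W.xDivisionField 3).integralClosureToAbsIntegers (𝓞 K))) =
      𝔓.comap ((W.xDivisionField 3).integralClosureToAbsIntegers (𝓞 K)) :=
    fun g hg => (Ideal.mem_ramificationSubgroup_iff.mp (hQ10 (hmem1 g hg))).1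
  have hliftfix : ∀ g, g ∈ Q1 → ∀ σ : absoluteGaloisGroup K, absRestrictNormalHom (W.xDivisionField 3) σ = g →
      σ • ζ = ζ ∧ σ • δ = δ := by
    intro g hg σ hσ
    refine ⟨?_, ?_⟩
    · have h : (((g • ζE : integralClosure (𝓞 K) (W.xDivisionField 3)) : W.xDivisionField 3) :
          AlgebraicClosure K) = ((ζE : W.xDivisionField 3) : AlgebraicClosure K) := by
        rw [hfixζ g (hQ10 (hmem1 g hg))]
      rw [hres g σ hσ] at h
      exact h
    · have h : (((g • δE : integralClosure (𝓞 K) (W.xDivisionField 3)) : W.xDivisionField 3) :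
          AlgebraicClosure K) = ((δE : W.xDivisionField 3) : AlgebraicClosure K) := by
        rw [hfixδ g (hmem1 g hg)]
      rw [hres g σ hσ] at h
      exact h
  have hsign : ∀ σ : absoluteGaloisGroup K, σ • ζ = ζ → σ • δ = δ →
      (σ • R₀ = R₀ ∨ σ • R₀ = -R₀) ∧ (σ • R₁ = R₁ ∨ σ • R₁ = -R₁) ∧ (σ • R₂ = R₂ ∨ σ • R₂ = -R₂) := by
    intro σ hσζ hσδ
    have hc4 : σ • algebraMap K (AlgebraicClosure K) W.c₄ = algebraMap K (AlgebraicClosure K) W.c₄ :=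
      smul_algebraMap σ W.c₄
    have e12 := hnumσ σ 12
    push_cast at e12
    have key : ∀ (R A : AlgebraicClosure K), R ^ 2 = A → σ • A = A → σ • R = R ∨ σ • R = -R := by
      intro R A hR hA
      have h' : (σ • R) ^ 2 = R ^ 2 := by rw [← smul_pow', hR, hA]
      have hm : (σ • R - R) * (σ • R + R) = 0 := by linear_combination h'
      rcases mul_eq_zero.mp hm with h | h
      · exact Or.inl (sub_eq_zero.mp h)
      · exact Or.inr (eq_neg_of_add_eq_zero_left h)
    refine ⟨key R₀ _ h₀ ?_, key R₁ _ h₁ ?_, key R₂ _ h₂ ?_⟩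
    · rw [smul_sub, smul_mul', hc4, e12, hσδ]
    · rw [smul_sub, smul_mul', smul_mul', hc4, e12, hσζ, hσδ]
    · rw [smul_sub, smul_mul', smul_mul', smul_pow', hc4, e12, hσζ, hσδ]
  -- the product `R₀ R₁ R₂ = c₆` is fixed, so the signs multiply to `+1`
  have hρσ : ∀ σ : absoluteGaloisGroup K, (σ • R₀) * (σ • R₁) * (σ • R₂) = R₀ * R₁ * R₂ := by
    intro σ
    rw [← smul_mul', ← smul_mul', hρ, smul_algebraMap]
  -- a lift fixing all `R_k` restricts to `1`
  have hone : ∀ σ : absoluteGaloisGroup K, σ • R₀ = R₀ → σ • R₁ = R₁ → σ • R₂ = R₂ →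
      absRestrictNormalHom (W.xDivisionField 3) σ = 1 := fun σ a b e =>
    (W.absRestrictNormalHom_xDivisionField_three_eq_one_iff_radical hζ hδ h₀ h₁ h₂ hρ σ).mpr ⟨a, b, e⟩
  -- the field elements `R₀, R₁ ∈ E` and the sign map on `Q₁`
  have hval : ∀ (g : W.xDivisionField 3 ≃ₐ[K] W.xDivisionField 3) (σ : absoluteGaloisGroup K),
      absRestrictNormalHom (W.xDivisionField 3) σ = g → ∀ (R : AlgebraicClosure K) (hR : R ∈ W.xDivisionField 3),
      (g ⟨R, hR⟩ = ⟨R, hR⟩ ↔ σ • R = R) := by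
    intro g σ hσ R hR
    rw [Subtype.ext_iff, hresf g σ hσ]
  let f : Q1 → Bool × Bool := fun g =>
    (decide ((g : W.xDivisionField 3 ≃ₐ[K] W.xDivisionField 3) ⟨R₀, mR₀⟩ = ⟨R₀, mR₀⟩),
     decide ((g : W.xDivisionField 3 ≃ₐ[K] W.xDivisionField 3) ⟨R₁, mR₁⟩ = ⟨R₁, mR₁⟩))
  have hf_inj : Function.Injective f := by
    rintro ⟨g, hg⟩ ⟨g', hg'⟩ hgg'
    simp only [f, Prod.mk.injEq, decide_eq_decide] at hgg'
    obtain ⟨e0, e1⟩ := hgg'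
    obtain ⟨σ, hσ⟩ := absRestrictNormalHom_surjective' (W.xDivisionField 3) g
    obtain ⟨σ', hσ'⟩ := absRestrictNormalHom_surjective' (W.xDivisionField 3) g'
    obtain ⟨fζ, fδ⟩ := hliftfix g hg σ hσ
    obtain ⟨fζ', fδ'⟩ := hliftfix g' hg' σ' hσ'
    obtain ⟨s0, s1, -⟩ := hsign σ fζ fδ
    obtain ⟨s0', s1', -⟩ := hsign σ' fζ' fδ'
    rw [hval g σ hσ, hval g' σ' hσ'] at e0 e1
    -- `σ R_k = σ' R_k` for `k = 0, 1`
    have a0 : σ • R₀ = σ' • R₀ := by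
      rcases s0 with h | h
      · rw [h, e0.mp h]
      · rcases s0' with h' | h'
        · rw [h', e0.mpr h']
        · rw [h, h']
    have a1 : σ • R₁ = σ' • R₁ := by
      rcases s1 with h | h
      · rw [h, e1.mp h]
      · rcases s1' with h' | h'
        · rw [h', e1.mpr h']
        · rw [h, h']
    -- `τ := σ⁻¹ σ'` fixes `R₀, R₁`, hence `R₂`
    have t0 : (σ⁻¹ * σ') • R₀ = R₀ := by rw [mul_smul, ← a0, inv_smul_smul]
    have t1 : (σ⁻¹ * σ') • R₁ = R₁ := by rw [mul_smul, ← a1, inv_smul_smul]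
    have t2 : (σ⁻¹ * σ') • R₂ = R₂ := by
      have h := hρσ (σ⁻¹ * σ')
      rw [t0, t1] at h
      exact mul_left_cancel₀ (mul_ne_zero hR₀ne hR₁ne) h
    have h1 := hone _ t0 t1 t2
    rw [map_mul, map_inv, hσ, hσ', inv_mul_eq_one] at h1
    exact Subtype.ext h1
  have hf_bij : Function.Bijective f :=
    hf_inj.bijective_of_nat_card_le (by rw [hcard1, Nat.card_prod]; simp)
  -- for each pair of signs there is `g ∈ Q₁` (with a lift `σ`) realising it
  have hpat : ∀ b₀ b₁ : Bool, ∃ (g : W.xDivisionField 3 ≃ₐ[K] W.xDivisionField 3) (σ : absoluteGaloisGroup K),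
      g ∈ Q1 ∧ absRestrictNormalHom (W.xDivisionField 3) σ = g ∧ σ • ζ = ζ ∧ σ • δ = δ ∧
      (σ • R₀ = R₀ ↔ b₀ = true) ∧ (σ • R₁ = R₁ ↔ b₁ = true) := by
    intro b₀ b₁
    obtain ⟨⟨g, hg⟩, hgb⟩ := hf_bij.2 (b₀, b₁)
    obtain ⟨σ, hσ⟩ := absRestrictNormalHom_surjective' (W.xDivisionField 3) g
    obtain ⟨fζ, fδ⟩ := hliftfix g hg σ hσ
    refine ⟨g, σ, hg, hσ, fζ, fδ, ?_, ?_⟩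
    · have h := congrArg Prod.fst hgb
      simp only [f] at h
      rw [← hval g σ hσ R₀ mR₀, ← decide_eq_true_iff (p := g ⟨R₀, mR₀⟩ = ⟨R₀, mR₀⟩), h]
    · have h := congrArg Prod.snd hgb
      simp only [f] at h
      rw [← hval g σ hσ R₁ mR₁, ← decide_eq_true_iff (p := g ⟨R₁, mR₁⟩ = ⟨R₁, mR₁⟩), h]
  -- the three non-trivial sign changes `g₂ = (+,-,-)`, `g₃ = (-,+,-)`, `g₄ = (-,-,+)`
  obtain ⟨g₂, σ₂, hg₂, hσ₂, f₂ζ, f₂δ, b₂0, b₂1⟩ := hpat true false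
  obtain ⟨g₃, σ₃, hg₃, hσ₃, f₃ζ, f₃δ, b₃0, b₃1⟩ := hpat false true
  obtain ⟨g₄, σ₄, hg₄, hσ₄, f₄ζ, f₄δ, b₄0, b₄1⟩ := hpat false false
  obtain ⟨s₂0, s₂1, s₂2⟩ := hsign σ₂ f₂ζ f₂δ
  obtain ⟨s₃0, s₃1, s₃2⟩ := hsign σ₃ f₃ζ f₃δ
  obtain ⟨s₄0, s₄1, s₄2⟩ := hsign σ₄ f₄ζ f₄δ
  have r₂0 : σ₂ • R₀ = R₀ := b₂0.mpr rfl
  have r₂1 : σ₂ • R₁ = -R₁ := s₂1.resolve_left (fun h => Bool.false_ne_true (b₂1.mp h))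
  have r₂2 : σ₂ • R₂ = -R₂ := by
    have h := hρσ σ₂
    rw [r₂0, r₂1] at h
    have : R₀ * R₁ * (σ₂ • R₂ + R₂) = 0 := by linear_combination (-1 : AlgebraicClosure K) * h
    rcases mul_eq_zero.mp this with h' | h'
    · exact absurd h' (mul_ne_zero hR₀ne hR₁ne)
    · exact eq_neg_of_add_eq_zero_left h'
  have r₃0 : σ₃ • R₀ = -R₀ := s₃0.resolve_left (fun h => Bool.false_ne_true (b₃0.mp h))
  have r₃1 : σ₃ • R₁ = R₁ := b₃1.mpr rfl
  have r₃2 : σ₃ • R₂ = -R₂ := by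
    have h := hρσ σ₃
    rw [r₃0, r₃1] at h
    have : R₀ * R₁ * (σ₃ • R₂ + R₂) = 0 := by linear_combination (-1 : AlgebraicClosure K) * h
    rcases mul_eq_zero.mp this with h' | h'
    · exact absurd h' (mul_ne_zero hR₀ne hR₁ne)
    · exact eq_neg_of_add_eq_zero_left h'
  have r₄0 : σ₄ • R₀ = -R₀ := s₄0.resolve_left (fun h => Bool.false_ne_true (b₄0.mp h))
  have r₄1 : σ₄ • R₁ = -R₁ := s₄1.resolve_left (fun h => Bool.false_ne_true (b₄1.mp h))
  have r₄2 : σ₄ • R₂ = R₂ := by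
    have h := hρσ σ₄
    rw [r₄0, r₄1] at h
    have : R₀ * R₁ * (σ₄ • R₂ - R₂) = 0 := by linear_combination h
    rcases mul_eq_zero.mp this with h' | h'
    · exact absurd h' (mul_ne_zero hR₀ne hR₁ne)
    · exact sub_eq_zero.mp h'
  -- moving the `Z`'s and `Y`'s by `g₂, g₃, g₄`
  set Qp : Polynomial K := (P.map (algebraMap (𝓞 K) K)) ^ 2 -
    Polynomial.C ((algebraMap (𝓞 K) K c) ^ 2) * (Polynomial.X ^ 3 - Polynomial.C (27 * W.c₄) * Polynomial.X
      - Polynomial.C (54 * W.c₆)) with hQp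
  have hQpeval : ∀ t : AlgebraicClosure K, Polynomial.aeval t Qp =
      (P.map (algebraMap (𝓞 K) (AlgebraicClosure K))).eval t ^ 2 -
        algebraMap (𝓞 K) (AlgebraicClosure K) c ^ 2 *
          (t ^ 3 - 27 * algebraMap K _ W.c₄ * t - 54 * algebraMap K _ W.c₆) := by
    intro t
    rw [Polynomial.eval_map, ← Polynomial.aeval_def]
    simp only [hQp, map_sub, map_mul, map_pow, Polynomial.aeval_C, Polynomial.aeval_X,
      Polynomial.aeval_map_algebraMap, map_ofNat]
    rw [← IsScalarTower.algebraMap_apply (𝓞 K) K (AlgebraicClosure K) c]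
  set Yp : Polynomial K := Polynomial.X ^ 3 - Polynomial.C (27 * W.c₄) * Polynomial.X
      - Polynomial.C (54 * W.c₆) with hYp
  have hYpeval : ∀ t : AlgebraicClosure K, Polynomial.aeval t Yp =
      t ^ 3 - 27 * algebraMap K _ W.c₄ * t - 54 * algebraMap K _ W.c₆ := by
    intro t
    simp only [hYp, map_sub, map_mul, map_pow, Polynomial.aeval_C, Polynomial.aeval_X, map_ofNat]
  have hmove : ∀ (g : W.xDivisionField 3 ≃ₐ[K] W.xDivisionField 3) (σ : absoluteGaloisGroup K),
      absRestrictNormalHom (W.xDivisionField 3) σ = g →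
      ∀ (S T : integralClosure (𝓞 K) (W.xDivisionField 3)) (p : Polynomial K) (s t : AlgebraicClosure K),
      ((S : W.xDivisionField 3) : AlgebraicClosure K) = Polynomial.aeval s p →
      ((T : W.xDivisionField 3) : AlgebraicClosure K) = Polynomial.aeval t p →
      σ • s = t → g • S = T := by
    intro g σ hσ S T p s t hS hT hst
    apply hinjE
    rw [hres g σ hσ, hS, hT, ← hst]
    let σ' : AlgebraicClosure K ≃ₐ[K] AlgebraicClosure K := σ
    change σ' (Polynomial.aeval s p) = Polynomial.aeval (σ' s) p
    rw [← AlgEquiv.coe_toAlgHom, ← Polynomial.aeval_algHom_apply]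
  have e3 : ∀ σ : absoluteGaloisGroup K, σ • (3 : AlgebraicClosure K) = 3 := fun σ => by
    have h := hnumσ σ 3; push_cast at h; exact h
  have hg₂Z : g₂ • Z = Z₂ := hmove g₂ σ₂ hσ₂ Z Z₂ Qp _ _ (by rw [hQpeval]; exact hZ) (by rw [hQpeval]; exact hZ₂)
    (by rw [smul_mul', e3, smul_add, smul_add, r₂0, r₂1, r₂2]; ring)
  have hg₃Z : g₃ • Z = Z₃ := hmove g₃ σ₃ hσ₃ Z Z₃ Qp _ _ (by rw [hQpeval]; exact hZ) (by rw [hQpeval]; exact hZ₃)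
    (by rw [smul_mul', e3, smul_add, smul_add, r₃0, r₃1, r₃2]; ring)
  have hg₄Z : g₄ • Z = Z₄ := hmove g₄ σ₄ hσ₄ Z Z₄ Qp _ _ (by rw [hQpeval]; exact hZ) (by rw [hQpeval]; exact hZ₄)
    (by rw [smul_mul', e3, smul_add, smul_add, r₄0, r₄1, r₄2]; ring)
  have hg₂Z₃ : g₂ • Z₃ = Z₄ := hmove g₂ σ₂ hσ₂ Z₃ Z₄ Qp _ _ (by rw [hQpeval]; exact hZ₃) (by rw [hQpeval]; exact hZ₄)
    (by rw [smul_mul', e3, smul_sub, smul_add, smul_neg, r₂0, r₂1, r₂2]; ring)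
  have hg₂Z₄ : g₂ • Z₄ = Z₃ := hmove g₂ σ₂ hσ₂ Z₄ Z₃ Qp _ _ (by rw [hQpeval]; exact hZ₄) (by rw [hQpeval]; exact hZ₃)
    (by rw [smul_mul', e3, smul_add, smul_sub, smul_neg, r₂0, r₂1, r₂2]; ring)
  have hg₃Z₂ : g₃ • Z₂ = Z₄ := hmove g₃ σ₃ hσ₃ Z₂ Z₄ Qp _ _ (by rw [hQpeval]; exact hZ₂) (by rw [hQpeval]; exact hZ₄)
    (by rw [smul_mul', e3, smul_sub, smul_sub, r₃0, r₃1, r₃2]; ring)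
  have hg₂Y : g₂ • Y₀ = Y₂ := hmove g₂ σ₂ hσ₂ Y₀ Y₂ Yp _ _ (by rw [hYpeval]; exact hY₀) (by rw [hYpeval]; exact hY₂)
    (by rw [smul_mul', e3, smul_add, smul_add, r₂0, r₂1, r₂2]; ring)
  have hg₃Y : g₃ • Y₀ = Y₃ := hmove g₃ σ₃ hσ₃ Y₀ Y₃ Yp _ _ (by rw [hYpeval]; exact hY₀) (by rw [hYpeval]; exact hY₃)
    (by rw [smul_mul', e3, smul_add, smul_add, r₃0, r₃1, r₃2]; ring)
  have hg₄Y : g₄ • Y₀ = Y₄ := hmove g₄ σ₄ hσ₄ Y₀ Y₄ Yp _ _ (by rw [hYpeval]; exact hY₀) (by rw [hYpeval]; exact hY₄)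
    (by rw [smul_mul', e3, smul_add, smul_add, r₄0, r₄1, r₄2]; ring)
  -- orders are invariant under `Q₁ ⊆ Q₀`
  have hordg : ∀ g, g ∈ Q1 → ∀ X : integralClosure (𝓞 K) (W.xDivisionField 3),
      ord (𝔓.comap ((W.xDivisionField 3).integralClosureToAbsIntegers (𝓞 K))) (g • X) =
        ord (𝔓.comap ((W.xDivisionField 3).integralClosureToAbsIntegers (𝓞 K))) X :=
    fun g hg X => ord_smul _ (hstab g hg) X
  -- `k · x = k · m` in `ℕ∞` forces `x = m`
  have hdiv : ∀ (k : ℕ), 0 < k → ∀ (x : ℕ∞) (m : ℕ), (k : ℕ∞) * x = ((k * m : ℕ) : ℕ∞) → x = m := by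
    intro k hk x m h
    induction x using ENat.recTopCoe with
    | top =>
      rw [ENat.mul_top (by exact_mod_cast hk.ne')] at h
      exact absurd h (ENat.top_ne_coe _)
    | coe a =>
      have h' : k * a = k * m := by exact_mod_cast h
      exact_mod_cast Nat.eq_of_mul_eq_mul_left hk h'
  -- `v(Z) = n`
  have hn : ord (𝔓.comap ((W.xDivisionField 3).integralClosureToAbsIntegers (𝓞 K))) Z = n := by
    refine hdiv 4 (by norm_num) _ n ?_
    rw [← hZprod, ord_mul _ hPE0, ord_mul _ hPE0, ord_mul _ hPE0, ← hg₂Z, ← hg₃Z, ← hg₄Z,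
      hordg g₂ hg₂, hordg g₃ hg₃, hordg g₄ hg₄]
    push_cast
    ring
  -- `v(Z_j - Z) = m_j`
  have hm₂ : ord (𝔓.comap ((W.xDivisionField 3).integralClosureToAbsIntegers (𝓞 K))) (Z₂ - Z) = m₂ := by
    rw [← neg_sub, ord_neg]
    refine hdiv 2 (by norm_num) _ m₂ ?_
    rw [← hE₀, ord_mul _ hPE0, show Z₃ - Z₄ = g₃ • (Z - Z₂) by rw [smul_sub, hg₃Z, hg₃Z₂],
      hordg g₃ hg₃]
    push_cast
    ring
  have hm₃ : ord (𝔓.comap ((W.xDivisionField 3).integralClosureToAbsIntegers (𝓞 K))) (Z₃ - Z) = m₃ := by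
    rw [← neg_sub, ord_neg]
    refine hdiv 2 (by norm_num) _ m₃ ?_
    rw [← hE₁, ord_mul _ hPE0, show Z₂ - Z₄ = g₂ • (Z - Z₃) by rw [smul_sub, hg₂Z, hg₂Z₃],
      hordg g₂ hg₂]
    push_cast
    ring
  have hm₄ : ord (𝔓.comap ((W.xDivisionField 3).integralClosureToAbsIntegers (𝓞 K))) (Z₄ - Z) = m₄ := by
    rw [← neg_sub, ord_neg]
    refine hdiv 2 (by norm_num) _ m₄ ?_
    rw [← hE₂, ord_mul _ hPE0, show Z₂ - Z₃ = g₂ • (Z - Z₄) by rw [smul_sub, hg₂Z, hg₂Z₄],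
      hordg g₂ hg₂]
    push_cast
    ring
  -- `v(Y₀) = n₀` from `∏_ε Y_ε = -2¹⁶ 3²¹ Δ²` (the identity is `N₄(0)`, Silverman AEC III §1)
  set C4 : AlgebraicClosure K := algebraMap K (AlgebraicClosure K) W.c₄ with hC4
  set C6 : AlgebraicClosure K := algebraMap K (AlgebraicClosure K) W.c₆ with hC6
  set DD : AlgebraicClosure K := algebraMap K (AlgebraicClosure K) W.Δ with hDD
  have hδD : δ ^ 3 = DD := hδ
  have hcrel : C6 ^ 2 = C4 ^ 3 - 1728 * DD := by
    have h := congrArg (algebraMap K (AlgebraicClosure K)) W.c_relation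
    rw [map_mul, map_sub, map_pow, map_pow, map_ofNat] at h
    linear_combination h
  have hnf1 : (3 * (R₀ + R₁ + R₂)) ^ 3 - 27 * C4 * (3 * (R₀ + R₁ + R₂)) - 54 * C6 =
      -(648 * δ * ζ * R₂ + (-648) * δ * ζ * R₁ + 648 * δ * R₂ + (-648) * δ * R₀ + (-108) * C4 * R₂ + (-108) * C4 * R₁ + (-108) * C4 * R₀ + (-108) * C6) := by
    linear_combination (-1 : AlgebraicClosure K) * ((324 * δ * R₂ + 972 * δ * R₁ + 972 * δ * R₀) * hζ + ((-81) * R₂ + (-81) * R₁ + (-27) * R₀) * h₀ + ((-81) * R₂ + (-27) * R₁ + (-81) * R₀) * h₁ + ((-27) * R₂ + (-81) * R₁ + (-81) * R₀) * h₂ + ((-162)) * hρ)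
  have hnf2 : (3 * (R₀ - R₁ - R₂)) ^ 3 - 27 * C4 * (3 * (R₀ - R₁ - R₂)) - 54 * C6 =
      -((-648) * δ * ζ * R₂ + 648 * δ * ζ * R₁ + (-648) * δ * R₂ + (-648) * δ * R₀ + 108 * C4 * R₂ + 108 * C4 * R₁ + (-108) * C4 * R₀ + (-108) * C6) := by
    linear_combination (-1 : AlgebraicClosure K) * (((-324) * δ * R₂ + (-972) * δ * R₁ + 972 * δ * R₀) * hζ + (81 * R₂ + 81 * R₁ + (-27) * R₀) * h₀ + (81 * R₂ + 27 * R₁ + (-81) * R₀) * h₁ + (27 * R₂ + 81 * R₁ + (-81) * R₀) * h₂ + ((-162)) * hρ)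
  have hnf3 : (3 * (-R₀ + R₁ - R₂)) ^ 3 - 27 * C4 * (3 * (-R₀ + R₁ - R₂)) - 54 * C6 =
      -((-648) * δ * ζ * R₂ + (-648) * δ * ζ * R₁ + (-648) * δ * R₂ + 648 * δ * R₀ + 108 * C4 * R₂ + (-108) * C4 * R₁ + 108 * C4 * R₀ + (-108) * C6) := by
    linear_combination (-1 : AlgebraicClosure K) * (((-324) * δ * R₂ + 972 * δ * R₁ + (-972) * δ * R₀) * hζ + (81 * R₂ + (-81) * R₁ + 27 * R₀) * h₀ + (81 * R₂ + (-27) * R₁ + 81 * R₀) * h₁ + (27 * R₂ + (-81) * R₁ + 81 * R₀) * h₂ + ((-162)) * hρ)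
  have hnf4 : (3 * (-R₀ - R₁ + R₂)) ^ 3 - 27 * C4 * (3 * (-R₀ - R₁ + R₂)) - 54 * C6 =
      -(648 * δ * ζ * R₂ + 648 * δ * ζ * R₁ + 648 * δ * R₂ + 648 * δ * R₀ + (-108) * C4 * R₂ + 108 * C4 * R₁ + 108 * C4 * R₀ + (-108) * C6) := by
    linear_combination (-1 : AlgebraicClosure K) * ((324 * δ * R₂ + (-972) * δ * R₁ + (-972) * δ * R₀) * hζ + ((-81) * R₂ + 81 * R₁ + 27 * R₀) * h₀ + ((-81) * R₂ + 27 * R₁ + 81 * R₀) * h₁ + ((-27) * R₂ + 81 * R₁ + 81 * R₀) * h₂ + ((-162)) * hρ)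
  have hnf12 : (648 * δ * ζ * R₂ + (-648) * δ * ζ * R₁ + 648 * δ * R₂ + (-648) * δ * R₀ + (-108) * C4 * R₂ + (-108) * C4 * R₁ + (-108) * C4 * R₀ + (-108) * C6) * ((-648) * δ * ζ * R₂ + 648 * δ * ζ * R₁ + (-648) * δ * R₂ + (-648) * δ * R₀ + 108 * C4 * R₂ + 108 * C4 * R₁ + (-108) * C4 * R₀ + (-108) * C6) =
      (-839808) * δ ^ 2 * R₁ * R₂ + 139968 * C4 * δ * R₁ * R₂ + (-23328) * C4 ^ 2 * R₁ * R₂ + 139968 * C6 * δ * R₀ + (-2519424) * C4 * δ ^ 2 + 23328 * C4 * C6 * R₀ + (-15116544) * DD := by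
    linear_combination ((-419904) * δ ^ 2 * R₂ ^ 2 + 839808 * δ ^ 2 * R₁ * R₂ + (-419904) * δ ^ 2 * R₁ ^ 2 + 5038848 * δ ^ 3 * ζ + (-1679616) * C4 * δ ^ 2 * ζ + (-10077696) * δ ^ 3 + 1679616 * C4 * δ ^ 2 + 139968 * C4 ^ 2 * δ) * hζ + (5038848) * hδD + (419904 * δ ^ 2 + 139968 * C4 * δ + 11664 * C4 ^ 2) * h₀ + (419904 * δ ^ 2 * ζ + (-139968) * C4 * δ * ζ + 419904 * δ ^ 2 + (-11664) * C4 ^ 2) * h₁ + ((-419904) * δ ^ 2 * ζ + 139968 * C4 * δ * ζ + 139968 * C4 * δ + (-11664) * C4 ^ 2) * h₂ + (11664) * hcrel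
  have hnf34 : ((-648) * δ * ζ * R₂ + (-648) * δ * ζ * R₁ + (-648) * δ * R₂ + 648 * δ * R₀ + 108 * C4 * R₂ + (-108) * C4 * R₁ + 108 * C4 * R₀ + (-108) * C6) * (648 * δ * ζ * R₂ + 648 * δ * ζ * R₁ + 648 * δ * R₂ + 648 * δ * R₀ + (-108) * C4 * R₂ + 108 * C4 * R₁ + 108 * C4 * R₀ + (-108) * C6) =
      839808 * δ ^ 2 * R₁ * R₂ + (-139968) * C4 * δ * R₁ * R₂ + 23328 * C4 ^ 2 * R₁ * R₂ + (-139968) * C6 * δ * R₀ + (-2519424) * C4 * δ ^ 2 + (-23328) * C4 * C6 * R₀ + (-15116544) * DD := by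
    linear_combination ((-419904) * δ ^ 2 * R₂ ^ 2 + (-839808) * δ ^ 2 * R₁ * R₂ + (-419904) * δ ^ 2 * R₁ ^ 2 + 5038848 * δ ^ 3 * ζ + (-1679616) * C4 * δ ^ 2 * ζ + (-10077696) * δ ^ 3 + 1679616 * C4 * δ ^ 2 + 139968 * C4 ^ 2 * δ) * hζ + (5038848) * hδD + (419904 * δ ^ 2 + 139968 * C4 * δ + 11664 * C4 ^ 2) * h₀ + (419904 * δ ^ 2 * ζ + (-139968) * C4 * δ * ζ + 419904 * δ ^ 2 + (-11664) * C4 ^ 2) * h₁ + ((-419904) * δ ^ 2 * ζ + 139968 * C4 * δ * ζ + 139968 * C4 * δ + (-11664) * C4 ^ 2) * h₂ + (11664) * hcrel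
  have hnfN : ((-839808) * δ ^ 2 * R₁ * R₂ + 139968 * C4 * δ * R₁ * R₂ + (-23328) * C4 ^ 2 * R₁ * R₂ + 139968 * C6 * δ * R₀ + (-2519424) * C4 * δ ^ 2 + 23328 * C4 * C6 * R₀ + (-15116544) * DD) * (839808 * δ ^ 2 * R₁ * R₂ + (-139968) * C4 * δ * R₁ * R₂ + 23328 * C4 ^ 2 * R₁ * R₂ + (-139968) * C6 * δ * R₀ + (-2519424) * C4 * δ ^ 2 + (-23328) * C4 * C6 * R₀ + (-15116544) * DD) =
      (-685529707511808) * DD ^ 2 := by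
    linear_combination (940369969152 * C4 ^ 3 * δ ^ 3 * ζ + (-78364164096) * C4 ^ 4 * δ ^ 2 * ζ + (-235092492288) * C4 ^ 3 * δ ^ 3 + 6530347008 * C4 ^ 5 * δ + (-101559956668416) * DD * δ ^ 3 * ζ + 33853318889472 * C4 * DD * δ ^ 2 * ζ + (-8463329722368) * C4 ^ 2 * DD * δ * ζ + 101559956668416 * DD * δ ^ 3 + (-25389989167104) * C4 * DD * δ ^ 2 + 5642219814912 * C4 ^ 2 * DD * δ) * hζ + ((-705277476864) * δ * R₁ ^ 2 * R₂ ^ 2 + 235092492288 * C4 * R₁ ^ 2 * R₂ ^ 2 + 705277476864 * C4 ^ 2 * ζ * R₂ ^ 2 + 235092492288 * C6 * R₀ * R₁ * R₂ + (-705277476864) * C4 ^ 3 * ζ + 6347497291776 * C4 ^ 2 * δ + 235092492288 * C4 ^ 3 + 235092492288 * C6 ^ 2 + (-101559956668416) * DD) * hδD + ((-19591041024) * C6 ^ 2 * δ ^ 2 + (-6530347008) * C4 * C6 ^ 2 * δ + (-544195584) * C4 ^ 2 * C6 ^ 2) * h₀ + ((-58773123072) * C4 ^ 2 * δ ^ 2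 * R₂ ^ 2 + 6530347008 * C4 ^ 3 * δ * R₂ ^ 2 + (-544195584) * C4 ^ 4 * R₂ ^ 2 + (-705277476864) * DD * δ * R₂ ^ 2 + 235092492288 * C4 * DD * R₂ ^ 2) * h₁ + ((-78364164096) * C4 ^ 3 * δ ^ 2 * ζ + 6530347008 * C4 ^ 4 * δ * ζ + (-58773123072) * C4 ^ 3 * δ ^ 2 + 6530347008 * C4 ^ 4 * δ + (-544195584) * C4 ^ 5 + 8463329722368 * DD * δ ^ 2 * ζ + (-2821109907456) * C4 * DD * δ * ζ + 705277476864 * C4 ^ 2 * DD * ζ + (-705277476864) * C4 * DD * δ + 235092492288 * C4 ^ 2 * DD) * h₂ + (1088391168 * C4 ^ 3 * C6 + 235092492288 * C6 * DD) * hρ + (58773123072 * C4 * δ ^ 2 + 544195584 * C4 ^ 3 + 470184984576 * DD) * hcrel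
  have hYprodval : ((Y₀ * Y₂ * Y₃ * Y₄ : integralClosure (𝓞 K) (W.xDivisionField 3)) : W.xDivisionField 3) =
      algebraMap (𝓞 K) (W.xDivisionField 3) (-(2 ^ 16 * 3 ^ 21 * D ^ 2)) := by
    apply Subtype.ext
    have hval : ∀ r : 𝓞 K, ((algebraMap (𝓞 K) (W.xDivisionField 3) r : W.xDivisionField 3) : AlgebraicClosure K) =
        algebraMap K (AlgebraicClosure K) (algebraMap (𝓞 K) K r) := fun r => rfl
    rw [hval, map_neg, map_mul, map_mul, map_pow, map_pow, map_pow, hD, map_neg, map_mul, map_mul,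
      map_pow, map_pow, map_pow, map_ofNat, map_ofNat, map_ofNat, map_ofNat]
    push_cast
    rw [hY₀, hY₂, hY₃, hY₄, hnf1, hnf2, hnf3, hnf4]
    have hp : ∀ a b e g : AlgebraicClosure K, (-a) * (-b) * (-e) * (-g) = (a * b) * (e * g) := fun a b e g => by ring
    rw [hp, hnf12, hnf34, hnfN, ← hDD]
    ring
  have hYprod : Y₀ * Y₂ * Y₃ * Y₄ = -(2 ^ 16 * 3 ^ 21 *
      (algebraMap (𝓞 K) (integralClosure (𝓞 K) (W.xDivisionField 3)) D) ^ 2) := by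
    have h : Y₀ * Y₂ * Y₃ * Y₄ = algebraMap (𝓞 K) (integralClosure (𝓞 K) (W.xDivisionField 3))
        (-(2 ^ 16 * 3 ^ 21 * D ^ 2)) := Subtype.ext hYprodval
    rw [h, map_neg, map_mul, map_mul, map_pow, map_pow, map_pow, map_ofNat, map_ofNat]
  have hord3 : ord (𝔓.comap ((W.xDivisionField 3).integralClosureToAbsIntegers (𝓞 K)))
      (3 : integralClosure (𝓞 K) (W.xDivisionField 3)) = 0 := by
    rw [ord, emultiplicity_eq_zero, Ideal.dvd_span_singleton]
    exact h3E
  have hn₀' : ord (𝔓.comap ((W.xDivisionField 3).integralClosureToAbsIntegers (𝓞 K))) Y₀ = n₀ := by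
    refine hdiv 4 (by norm_num) _ n₀ ?_
    have h4 : (4 : ℕ∞) * ord (𝔓.comap ((W.xDivisionField 3).integralClosureToAbsIntegers (𝓞 K))) Y₀ =
        ord (𝔓.comap ((W.xDivisionField 3).integralClosureToAbsIntegers (𝓞 K))) (Y₀ * Y₂ * Y₃ * Y₄) := by
      rw [ord_mul _ hPE0, ord_mul _ hPE0, ord_mul _ hPE0, ← hg₂Y, ← hg₃Y, ← hg₄Y,
        hordg g₂ hg₂, hordg g₃ hg₃, hordg g₄ hg₄]
      ring
    push_cast
    rw [h4, hYprod, ord_neg, ord_mul _ hPE0, ord_mul _ hPE0, ord_pow _ hPE0, ord_pow _ hPE0, ord_pow _ hPE0,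
      ho₂, hord3, hoD]
    have : ((4 * n₀ : ℕ) : ℕ∞) = ((16 * o₂ + 2 * oD : ℕ) : ℕ∞) := by rw [hn₀]
    push_cast at this
    rw [this]
    ring
  -- (S7) `K(E[3])` is wildly ramified at `𝔓`: `4 = #Q₁ ∣ #Q₀ ∣ #G₀`, so `#G₁ = 2^{v₂(#G₀)} ≥ 4`
  have hne : (𝔓.comap ((W.divisionField 3).integralClosureToAbsIntegers (𝓞 K))).ramificationSubgroup
      (W.divisionField 3 ≃ₐ[K] W.divisionField 3) 1 ≠ ⊥ := by
    have hle : W.xDivisionField 3 ≤ W.divisionField 3 := W.xDivisionField_le_divisionField 3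
    haveI : IsGalois K (W.divisionField 3) := {}
    haveI : Normal K (IntermediateField.restrict hle) :=
      Normal.of_algEquiv (IntermediateField.restrict_algEquiv hle)
    haveI hPFmax : (𝔓.comap ((W.divisionField 3).integralClosureToAbsIntegers (𝓞 K))).IsMaximal :=
      isMaximal_comap_integralClosureToAbsIntegers (𝓞 K) 𝔓 (W.divisionField 3)
    -- `#Q₀ ∣ #G₀`
    have hlayer := card_ramificationSubgroup_layer_eq (𝔓 := 𝔓) (W.divisionField 3) (W.xDivisionField 3) hle 0
    have hmap := map_inertia_restrictNormalHom (𝓞 K) (IntermediateField.restrict hle)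
      (𝔓.comap ((W.divisionField 3).integralClosureToAbsIntegers (𝓞 K)))
    have hdvd : Nat.card ((𝔓.comap ((W.xDivisionField 3).integralClosureToAbsIntegers (𝓞 K))).ramificationSubgroup
        (W.xDivisionField 3 ≃ₐ[K] W.xDivisionField 3) 0) ∣
        Nat.card ((𝔓.comap ((W.divisionField 3).integralClosureToAbsIntegers (𝓞 K))).ramificationSubgroup
        (W.divisionField 3 ≃ₐ[K] W.divisionField 3) 0) := by
      rw [hlayer, Ideal.ramificationSubgroup_zero, Ideal.ramificationSubgroup_zero]
      have hd := Subgroup.card_dvd_of_surjective _ (MonoidHom.subgroupMap_surjective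
        (AlgEquiv.restrictNormalHom (IntermediateField.restrict hle))
        ((𝔓.comap ((W.divisionField 3).integralClosureToAbsIntegers (𝓞 K))).inertia
          (W.divisionField 3 ≃ₐ[K] W.divisionField 3)))
      have e1 := Nat.card_congr (MulEquiv.subgroupCongr hmap).toEquiv
      exact (dvd_of_eq e1.symm).trans hd
    -- `4 ∣ #Q₀`
    have h4 : 4 ∣ Nat.card ((𝔓.comap ((W.xDivisionField 3).integralClosureToAbsIntegers (𝓞 K))).ramificationSubgroup
        (W.xDivisionField 3 ≃ₐ[K] W.xDivisionField 3) 0) := by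
      rw [← hcard]
      exact Subgroup.card_dvd_of_le hQ10
    have hG := card_ramificationSubgroup_one_eq_two_pow_of_mem_primesAbove hv2 h𝔓 (W.divisionField 3)
    intro hbot
    rw [hbot, Subgroup.card_bot] at hG
    have hpos : 0 < Nat.card ((𝔓.comap ((W.divisionField 3).integralClosureToAbsIntegers (𝓞 K))).ramificationSubgroup
        (W.divisionField 3 ≃ₐ[K] W.divisionField 3) 0) := Nat.card_pos
    have h2le : 2 ≤ (Nat.card ((𝔓.comap ((W.divisionField 3).integralClosureToAbsIntegers (𝓞 K))).ramificationSubgroup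
        (W.divisionField 3 ≃ₐ[K] W.divisionField 3) 0)).factorization 2 := by
      rw [← Nat.Prime.pow_dvd_iff_le_factorization Nat.prime_two hpos.ne']
      exact h4.trans hdvd
    have h1 : (2 : ℕ) ^ 2 ≤ 2 ^ (Nat.card ((𝔓.comap ((W.divisionField 3).integralClosureToAbsIntegers (𝓞 K))).ramificationSubgroup
        (W.divisionField 3 ≃ₐ[K] W.divisionField 3) 0)).factorization 2 := Nat.pow_le_pow_right two_pos h2le
    rw [← hG] at h1
    norm_num at h1
  exact W.card_mul_swanConductorAt_torsion_three_eq_of_fakePoint hv2 h3 h𝔓 hζ hδ h₀ h₁ h₂ hρ hne hcard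
    hZ hZ₂ hZ₃ hZ₄ hY₀ hs₀ hn hnu hn₀' hκ hm₂ hm₃ hm₄ hm₂b hm₃b hm₄b

end WeierstrassCurve

end
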